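import Summits.AtomisticToContinuum.Crystallization.Theorems.PricedLinkCensusLocalToGlobalDefs
import Literature.Analysis.FluidPDE.WholeSpaceIBP

/-!
# Testing a weak divergence against a decaying `C¹` function (cut-off removal)

Route `PricedLinkCensus`, crux `LocalToGlobal` (stmt-AtomisticToContinuum-14232), line
`flux-cell-joint-census`, support for the registered stub `stub_confinedThomson : ConfinedThomson`.
On a finite-dimensional real inner product space `E` (Lebesgue measure): if a square-integrable field
`V` has weak divergence `g` in the sense `∫ ⟪V, ∇φ⟫ = -∫ g φ` for all `φ ∈ C¹_c(E)`, then the identity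
extends to every `C¹` function `v` with `v, ∇v ∈ L²` and `g v ∈ L¹`:

  `∫ ⟪V, ∇v⟫ = -∫ g v`   (`integral_inner_gradient_eq_of_weakDiv`).

Proof: test with `φ_R = χ_R v`, `χ_R` the tree's smooth cut-off `Literature.Analysis.FluidPDE.cutoff R`
(`= 1` on `B̄(0,R)`, supported in `B̄(0,2R)`, `‖∇χ_R‖ ≤ C/R`), so `∇φ_R = χ_R ∇v + v ∇χ_R`; the first term
tends to `∫⟪V, ∇v⟫` by dominated convergence (`|⟪V,∇v⟫| ≤ ‖V‖‖∇v‖ ∈ L¹`), the second is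
`≤ (C/R) ∫ |v| ‖V‖ → 0`, and `∫ g χ_R v → ∫ g v`.  This is the standard removal of the compact-support
restriction in the weak formulation for `H(div) × H¹` pairings on the whole space (Lieb–Loss, Thm 7.7 ff.;
Evans, §5.2–5.3), used twice in the Thomson inequality: with `V = F` (an admissible flux) and with
`V = ∇u` (energy identity `∫‖∇u‖² = -∫ u Δu`).

References: E. H. Lieb, M. Loss, *Analysis* (2001), §7.7–7.9; L. C. Evans, *PDE* (2010), §5.2, App. C.2.
-/

noncomputable section

open MeasureTheory Set Filter Metric Topology InnerProductSpace Function
open scoped RealInnerProductSpace Topology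

namespace Summit.AtomisticToContinuum.Crystallization.Theorems.PricedLinkCensusLocalToGlobal

variable {E : Type*} [NormedAddCommGroup E] [InnerProductSpace ℝ E] [FiniteDimensional ℝ E]
  [MeasurableSpace E] [BorelSpace E]

omit [FiniteDimensional ℝ E] [MeasurableSpace E] [BorelSpace E] in
/-- Leibniz rule inside the pairing: `⟪V, ∇(χ v)⟫ = χ ⟪V, ∇v⟫ + v ⟪V, ∇χ⟫`. [folklore] -/
theorem inner_gradient_mul_apply [CompleteSpace E] {χ v : E → ℝ} {x : E} (hχ : DifferentiableAt ℝ χ x)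
    (hv : DifferentiableAt ℝ v x) (V : E) :
    ⟪V, gradient (fun y => χ y * v y) x⟫ = χ x * ⟪V, gradient v x⟫ + v x * ⟪V, gradient χ x⟫ := by
  rw [gradient, show (fun y => χ y * v y) = χ * v from rfl, (hχ.hasFDerivAt.mul hv.hasFDerivAt).fderiv, map_add,
    map_smul, map_smul, inner_add_right, inner_smul_right, inner_smul_right, gradient, gradient]

omit [FiniteDimensional ℝ E] [MeasurableSpace E] [BorelSpace E] in
/-- `|⟪V, ∇χ(x)⟫| ≤ ‖V‖ ‖Dχ(x)‖` (the gradient has the norm of the derivative). [folklore] -/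
theorem abs_inner_gradient_le [CompleteSpace E] (χ : E → ℝ) (x V : E) :
    |⟪V, gradient χ x⟫| ≤ ‖V‖ * ‖fderiv ℝ χ x‖ := by
  refine (abs_real_inner_le_norm _ _).trans_eq ?_
  rw [gradient, LinearIsometryEquiv.norm_map]

/-- The pairing `⟪V, W⟫` of two square-integrable fields is integrable (Cauchy–Schwarz pointwise and
Hölder `L² · L² ⊆ L¹`). [folklore] -/
theorem integrable_inner_of_memLp_two {V W : E → E} (hV : MemLp V 2 volume) (hW : MemLp W 2 volume) :
    Integrable fun x => ⟪V x, W x⟫ := by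
  have h : Integrable (fun x => ‖V x‖ * ‖W x‖) := by
    have := MemLp.integrable_mul hV.norm hW.norm
    exact this
  refine h.mono' (hV.aestronglyMeasurable.inner hW.aestronglyMeasurable) (Eventually.of_forall fun x => ?_)
  rw [Real.norm_eq_abs]
  exact abs_real_inner_le_norm _ _

/-- The product `|v| ‖V‖` of a square-integrable scalar and a square-integrable field is integrable. [folklore] -/
theorem integrable_abs_mul_norm_of_memLp_two {v : E → ℝ} {V : E → E} (hv : MemLp v 2 volume)
    (hV : MemLp V 2 volume) : Integrable fun x => |v x| * ‖V x‖ := by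
  have := MemLp.integrable_mul hv.norm hV.norm
  exact this

/-- **Cut-off removal in a weak divergence identity.** Let `V ∈ L²(E; E)` satisfy
`∫ ⟪V, ∇φ⟫ = -∫ g φ` for every `φ ∈ C¹_c(E)`.  If `v ∈ C¹(E)` with `v ∈ L²`, `∇v ∈ L²` and `g v ∈ L¹`, then
`∫ ⟪V, ∇v⟫ = -∫ g v`. [cite: LiebLoss2001, Thm 7.7] -/
theorem integral_inner_gradient_eq_of_weakDiv {V : E → E} {v g : E → ℝ} (hV : MemLp V 2 volume)
    (hv : ContDiff ℝ 1 v) (hv2 : MemLp v 2 volume) (hdv : MemLp (gradient v) 2 volume)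
    (hgv : Integrable fun x => g x * v x)
    (hweak : ∀ φ : E → ℝ, ContDiff ℝ 1 φ → HasCompactSupport φ →
      ∫ x, ⟪V x, gradient φ x⟫ = -∫ x, g x * φ x) :
    ∫ x, ⟪V x, gradient v x⟫ = -∫ x, g x * v x := by
  haveI : CompleteSpace E := FiniteDimensional.complete ℝ E
  obtain ⟨C, hC0, hC⟩ := Literature.Analysis.FluidPDE.exists_norm_fderiv_cutoff_le (E := E)
  -- the cut-offs and the test functions
  set χ : ℕ → E → ℝ := fun n => Literature.Analysis.FluidPDE.cutoff ((n : ℝ) + 1) with hχ_def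
  have hpos : ∀ n : ℕ, (0 : ℝ) < (n : ℝ) + 1 := fun n => by positivity
  have hχ1 : ∀ n, ContDiff ℝ 1 (χ n) := fun n => Literature.Analysis.FluidPDE.contDiff_cutoff _
  have hχc : ∀ n, HasCompactSupport (χ n) := fun n =>
    Literature.Analysis.FluidPDE.hasCompactSupport_cutoff (hpos n)
  have hχle : ∀ n x, |χ n x| ≤ 1 := fun n x => Literature.Analysis.FluidPDE.abs_cutoff_le_one _ _
  have hχD : ∀ n x, ‖fderiv ℝ (χ n) x‖ ≤ C / ((n : ℝ) + 1) := fun n x => hC _ (hpos n) x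
  have hχlim : ∀ x, Tendsto (fun n => χ n x) atTop (𝓝 1) := fun x =>
    Literature.Analysis.FluidPDE.tendsto_cutoff_natCast_add_one x
  have hvd : ∀ x, DifferentiableAt ℝ v x := fun x => hv.differentiable one_ne_zero x
  have hχd : ∀ n x, DifferentiableAt ℝ (χ n) x := fun n x => (hχ1 n).differentiable one_ne_zero x
  -- the tested identity, expanded by Leibniz
  have hI1 : ∀ n, Integrable fun x => χ n x * ⟪V x, gradient v x⟫ := fun n => by
    refine (integrable_inner_of_memLp_two hV hdv).mono
      (((hχ1 n).continuous.aestronglyMeasurable).mul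
        (hV.aestronglyMeasurable.inner hdv.aestronglyMeasurable)) (Eventually.of_forall fun x => ?_)
    rw [Real.norm_eq_abs, abs_mul, Real.norm_eq_abs]
    exact mul_le_of_le_one_left (abs_nonneg _) (hχle n x)
  have hgradχ : ∀ n, Continuous (gradient (χ n)) := fun n =>
    Literature.Analysis.FluidPDE.continuous_gradient_of_contDiff (hχ1 n)
  have hI2 : ∀ n, Integrable fun x => v x * ⟪V x, gradient (χ n) x⟫ := fun n => by
    refine ((integrable_abs_mul_norm_of_memLp_two hv2 hV).const_mul (C / ((n : ℝ) + 1))).mono'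
      (hv.continuous.aestronglyMeasurable.mul
        (hV.aestronglyMeasurable.inner (hgradχ n).aestronglyMeasurable)) (Eventually.of_forall fun x => ?_)
    rw [Real.norm_eq_abs, abs_mul]
    calc |v x| * |⟪V x, gradient (χ n) x⟫| ≤ |v x| * (‖V x‖ * (C / ((n : ℝ) + 1))) :=
        mul_le_mul_of_nonneg_left ((abs_inner_gradient_le _ _ _).trans
          (mul_le_mul_of_nonneg_left (hχD n x) (norm_nonneg _))) (abs_nonneg _)
      _ = C / ((n : ℝ) + 1) * (|v x| * ‖V x‖) := by ring
  have htest : ∀ n, (∫ x, χ n x * ⟪V x, gradient v x⟫) + ∫ x, v x * ⟪V x, gradient (χ n) x⟫ =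
      -∫ x, g x * (χ n x * v x) := fun n => by
    have h := hweak (fun x => χ n x * v x) ((hχ1 n).mul hv) ((hχc n).mul_right)
    rw [← h, ← integral_add (hI1 n) (hI2 n)]
    refine integral_congr_ae (Eventually.of_forall fun x => ?_)
    exact (inner_gradient_mul_apply (hχd n x) (hvd x) (V x)).symm
  -- limits of the three terms
  have hL1 : Tendsto (fun n => ∫ x, χ n x * ⟪V x, gradient v x⟫) atTop (𝓝 (∫ x, ⟪V x, gradient v x⟫)) := by
    refine tendsto_integral_of_dominated_convergence (fun x => ‖V x‖ * ‖gradient v x‖)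
      (fun n => (hI1 n).aestronglyMeasurable) (MemLp.integrable_mul hV.norm hdv.norm) (fun n => ?_) ?_
    · refine Eventually.of_forall fun x => ?_
      rw [Real.norm_eq_abs, abs_mul]
      exact (mul_le_of_le_one_left (abs_nonneg _) (hχle n x)).trans (abs_real_inner_le_norm _ _)
    · refine Eventually.of_forall fun x => ?_
      simpa using (hχlim x).mul_const ⟪V x, gradient v x⟫
  have hL2 : Tendsto (fun n => ∫ x, v x * ⟪V x, gradient (χ n) x⟫) atTop (𝓝 0) := by
    have hK : Tendsto (fun n : ℕ => C / ((n : ℝ) + 1) * ∫ x, |v x| * ‖V x‖) atTop (𝓝 0) := by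
      have h1 : Tendsto (fun n : ℕ => C / ((n : ℝ) + 1)) atTop (𝓝 0) := by
        have := (tendsto_const_div_atTop_nhds_zero_nat C).comp (tendsto_add_atTop_nat 1)
        refine this.congr fun n => ?_
        simp [Function.comp, Nat.cast_add]
      simpa using h1.mul_const (∫ x, |v x| * ‖V x‖)
    refine squeeze_zero_norm (fun n => ?_) hK
    rw [← integral_const_mul]
    refine norm_integral_le_of_norm_le ((integrable_abs_mul_norm_of_memLp_two hv2 hV).const_mul _)
      (Eventually.of_forall fun x => ?_)
    rw [Real.norm_eq_abs, abs_mul]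
    calc |v x| * |⟪V x, gradient (χ n) x⟫| ≤ |v x| * (‖V x‖ * (C / ((n : ℝ) + 1))) :=
        mul_le_mul_of_nonneg_left ((abs_inner_gradient_le _ _ _).trans
          (mul_le_mul_of_nonneg_left (hχD n x) (norm_nonneg _))) (abs_nonneg _)
      _ = C / ((n : ℝ) + 1) * (|v x| * ‖V x‖) := by ring
  have hR : Tendsto (fun n => -∫ x, g x * (χ n x * v x)) atTop (𝓝 (-∫ x, g x * v x)) := by
    refine (tendsto_integral_of_dominated_convergence (fun x => ‖g x * v x‖)
      (fun n => ?_) hgv.norm (fun n => ?_) ?_).neg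
    · exact (hgv.aestronglyMeasurable.mul (hχ1 n).continuous.aestronglyMeasurable).congr
        (Eventually.of_forall fun x => by simp only [Pi.mul_apply]; ring)
    · refine Eventually.of_forall fun x => ?_
      rw [show g x * (χ n x * v x) = χ n x * (g x * v x) by ring, norm_mul, Real.norm_eq_abs]
      exact mul_le_of_le_one_left (norm_nonneg _) (hχle n x)
    · refine Eventually.of_forall fun x => ?_
      have := ((hχlim x).const_mul (g x)).mul_const (v x)
      simpa [mul_assoc] using this
  -- conclude
  have hsum := hL1.add hL2
  rw [add_zero] at hsum
  exact tendsto_nhds_unique (hsum.congr fun n => (htest n)) hR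

/-- **Registered sub-goal `weakDiv_pairing_E8`** (line `flux-cell-joint-census`, support of
`stub_confinedThomson`): the cut-off removal `integral_inner_gradient_eq_of_weakDiv` on `ℝ⁸`, binder form.
[cite: LiebLoss2001, Thm 7.7] -/
theorem weakDiv_pairing_E8 : ∀ (V : E8 → E8) (v g : E8 → ℝ), MeasureTheory.MemLp V 2 MeasureTheory.volume →
    ContDiff ℝ 1 v → MeasureTheory.MemLp v 2 MeasureTheory.volume →
    MeasureTheory.MemLp (gradient v) 2 MeasureTheory.volume →
    MeasureTheory.Integrable (fun x => g x * v x) MeasureTheory.volume →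
    (∀ φ : E8 → ℝ, ContDiff ℝ 1 φ → HasCompactSupport φ →
      ∫ x, inner ℝ (V x) (gradient φ x) = -∫ x, g x * φ x) →
    ∫ x, inner ℝ (V x) (gradient v x) = -∫ x, g x * v x :=
  fun _ _ _ hV hv hv2 hdv hgv hweak => integral_inner_gradient_eq_of_weakDiv hV hv hv2 hdv hgv hweak

end Summit.AtomisticToContinuum.Crystallization.Theorems.PricedLinkCensusLocalToGlobal

end
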